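import Literature.MathematicalPhysics.QuantumFieldTheory.Balaban1983to89.B8SockB9P3SrcAtTopCubeTower
import Literature.MathematicalPhysics.QuantumFieldTheory.Balaban1983to89.B8SockB9P3H2AtTopCubeTowerMember

/-!
# `Balaban1983to89.B8SockB9P3SrcAtTopCubeTowerMember` — [Balaban1985RegularSpaces] (1.146) p. 101, (1.57)–(1.59) p. 86, (1.5) p. 77, (1.131) p. 99: THE SOURCED
# b9-SOCKET OF PROPOSITION 3's FRAME AT THE LAW MEMBERS OVER PRINT'S TOP-CUBE TOWER (the `ZdIdx` ∕ `IdxB8Laws` ∕ `IdxB8SubD` reading of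
# `B8SockB9P3SrcAtTopCubeTower`)

statement-level skeleton of published theorems with citation tags; proofs where landed; nothing here is a claim about the
Yang–Mills mass gap

`[Balaban1985RegularSpaces]` ("B8", CMP **99** (1985) 75–102) (1.146) p. 101, (1.57)–(1.59) p. 86, (1.3)–(1.5) p. 77, (1.68) p. 88, (1.131) p. 99; [B11] =
`[Balaban1985Variational]` (3) p. 278 (the level sets `Λ_j` of a law member); [4] = `[Balaban1985BackgroundPropagators]` Thm 3.3 p. 399.

CITATION HEADER (lean-in-tree rule).  Cell `pub-ymgap` (YM Track A, HUMAN RULING D-0062 ∕ D-0149), node N05 = [B8], width seat `pub-ymgap-dag-n05-w3` (g4), CLAIM-2 file (F).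
WHY.  The P₂D slot's SOURCED binder `SB9srcHP` (dag-n05-d p619291) quantifies over the LAW MEMBERS `i : ZdIdx` (`i.Ω 0 = T`, `IdxB8LawsB`, `DomainSeq`, the (1.5) tower
clause) with `i.η, i.k, i.Ω, i.Λs i.k` in the text; `B8SockB9P3SrcAtTopCubeTower.exists_sockB9P3src_topCube` proves that text at `Ω := (T, □₁, …, □_k)` for restriction
families of print's shape.  THIS FILE reads it at the law members over such a tower: the laws force `i.Λs i.k 0 = T ∖ □₁` and `i.Λs i.k j = Λ′_j` (dag-n05-w2's
`Λs_eq_lam_of_lamTop` + `B8SockB9P3H2AtTopCubeTowerMember.lamK_cubeFam_true_zero ∕ _pos`), so the text holds AT EVERY LAW MEMBER whose tower is a top-cube tower of the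
given shape — ★★★ `sockB9P3src_topCube_lawMember` (hypotheses `IdxB8Laws`, `DomainSeq`, (1.5): exactly the slot's, `IdxB8LawsB.toIdxB8Laws`), ★★ `sockB9P3src_topCube_lawMember_onePoint`
([4] (3.40)'s one-point pair class on line 5 = `B8Prop3SrcZd3HPGamma`'s `SB9srcH` letter at a member), ★★★ `sockB9P3src_topCube_idxB8SubD`
(the index of record), ★ `exists_idxB8SubD_sockB9P3src_topCube` (non-vacuity: such members exist, dag-n05-w2's `exists_idxB8SubD_cubeFam`).

HONEST SCOPE ∕ A6 — READ THIS.  PER MEMBER SHAPE `(L, M, ρ, k)`: the constants are NOT uniform in the member (NOT [4] Thm 3.3 with source = N06's object layer); the slot's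
binder asks ONE `(B₀, B₀β, cP3, γ″, γβ)` for ALL law members — not supplied here; no knit hypothesis inhabited as typed; no letter of [4] assumed or proved.  Count-neutral;
N05 NOT discharged; no count claim; one finite `𝕋⁴` programme at fixed `ε`, Bałaban as printed; the YM mass gap (Clay) is NOT proved by any of this — R4 closes the
conditional finite-`𝕋⁴` rung `BalabanLadder.UV` only; nothing continuum ∕ ℝ⁴ ∕ OS.  No `sorry`, no `def`, no `instance`, no `notation`.  Unit `pub-ymgap-dag-n05-w3` (g4), 2026-08-28.
-/

noncomputable section

namespace Literature.MathematicalPhysics.QuantumFieldTheory.Balaban1983to89.B8SockB9P3SrcAtTopCubeTowerMember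

open B7Prop1Explicit B7Prop1Local
open B7Prop2Explicit (unitaryUnits)
open B7Prop4GeneralLevels (linCovIter)
open B8Ineq132 (covDerivFwd InAk)
open B8Eq140Level (SideTouches)
open B8Eq146AExpansion (iEta plaqCovDeriv)
open B8Eq143PlaqExpansion (pdiv)
open B8Eq155JBound (Jcur wsup)
open B8ScaledSupNorm (bondNorm msup Bdd)
open B8Eq138LandauZd (IsLandau146W InR138 covLap)
open B8Eq184Proof (cfgExp)
open B8Lemma1NonAbelian (mulCfg)
open B9Eq340HolderZd (hquot AdmPair)
open B8LeafModelZd (ZdIdx)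
open B8ConstraintBonds (DomainSeq Lam)
open B8Eq131Cubes (cube)
open B8Eq131CubesAdmissible (cubeFam)
open B8CubeMemberZd (cubeLamS)
open B8TowerBondsPrinted (towerBondsP)
open B8IdxB8SubDRigidity (Λs_eq_lam_of_lamTop exists_idxB8SubD_cubeFam)
open B8SockB9P3H2AtTopCubeTowerMember (lamK_cubeFam_true_zero lamK_cubeFam_true_pos)
open B8SockB9P3SrcAtTopCubeTower (srcLines_topCube exists_sockB9P3src_topCube)
open Node00 (Stage3Params IdxB8Laws IdxB8SubD)

-- `Site` alone would resolve to the torus sites of `Setup.lean`; re-export the `ℤ^d` sites of `B7Prop1Explicit`.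
export B7Prop1Explicit (Site)

/-- ★★★ **THE SOURCED b9-SOCKET OF PROPOSITION 3's FRAME HOLDS AT EVERY LAW MEMBER OVER A TOP-CUBE TOWER OF ONE SHAPE** (the slot's `SB9srcHP` text with
`i.η, i.k, i.Ω, i.Λs i.k`; hypotheses `IdxB8Laws`, `DomainSeq`, the (1.5) tower clause — the slot's, after `IdxB8LawsB.toIdxB8Laws`; `i.Ω 0 = T` is automatic).  For
`θ.D ≥ 2`, `θ.L ≤ ρ`, `k ≥ 1`, `β ≥ 0`, `len z ≥ 1` (`z ≠ 0`), `θ.𝔸` finite-dimensional and every `γ₈ > 0`: `∃ B₀ B₀β cP3 γ″ γβ > 0` such that at every position `a`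
and every law member `i` with `i.Ω = (T, □₁(a), …, □_k(a))`, `i.k = k`, the five sourced lines of (1.59) hold with `B₀(|J|₍₋₃₎ + |B₁|) + γ″B₀(α₀+α₁)` (line 5:
`B₀β(…) + γβ(α₀+α₁)`).  PER MEMBER SHAPE — NOT [4] Thm 3.3. [cite: Balaban1985RegularSpaces, (1.146) p.101, (1.57)–(1.59) p.86, (1.5) p.77, (1.68) p.88, (1.131) p.99; Balaban1985Variational, (3) p.278; Balaban1985BackgroundPropagators, Thm 3.3 p.399] -/
theorem sockB9P3src_topCube_lawMember (θ : Stage3Params) [FiniteDimensional ℂ θ.𝔸] (hD : 2 ≤ θ.D) (M : ℕ) {ρ : ℕ} (hρ : θ.L ≤ ρ)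
    {k : ℕ} (hk : 1 ≤ k) {β : ℝ} (hβ : 0 ≤ β) {len : Site θ.D → ℝ} (hlen : ∀ z : Site θ.D, z ≠ 0 → 1 ≤ len z) {γ₈ : ℝ} (hγ₈ : 0 < γ₈) :
    ∃ B₀ B₀β cP3 γ'' γβ : ℝ, 0 < B₀ ∧ 0 < B₀β ∧ 0 < cP3 ∧ 0 < γ'' ∧ 0 < γβ ∧
      ∀ (a : Site θ.D) (i : ZdIdx θ.D θ.L), i.Ω = cubeFam true θ.L a M ρ k → i.k = k →
      IdxB8Laws θ.L i → DomainSeq θ.L i.Ω → (∀ l, l < i.k → ∀ z ∈ i.Λs i.k l, ((θ.L : ℤ) ^ l) • z ∈ Lam θ.L i.Ω l) →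
      ∀ α₀ α₁ α₂ : ℝ, 0 < α₀ → α₀ ≤ cP3 → 0 < α₁ → 0 < α₂ → α₂ ≤ cP3 →
        ∀ (U₀ W : Site θ.D → Fin θ.D → θ.𝔸ˣ), (∀ x κ, U₀ x κ ∈ unitaryUnits θ.𝔸) → (∀ x κ, W x κ ∈ unitaryUnits θ.𝔸) →
        ∀ f : Site θ.D → θ.𝔸, InR138 θ.L i.k i.η (i.Ω 0) (i.Λs i.k) U₀ f →
        (∀ x, IsSelfAdjoint (f x)) → (∀ x, x ∉ i.Ω 0 → f x = 0) →
        Bdd θ.L i.k i.η (-(2 : ℝ)) (fun j (x : Site θ.D) => x ∈ i.Ω j) f →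
        msup θ.L i.k i.η (-(2 : ℝ)) (fun j (x : Site θ.D) => x ∈ i.Ω j) f < γ₈ * (α₀ + α₁) →
        msup θ.L i.k i.η (-(3 : ℝ)) (fun j (p : Fin θ.D × Site θ.D) => p.2 ∈ i.Ω j) (fun p => covDerivFwd i.η U₀ p.1 f p.2) < γ₈ * (α₀ + α₁) →
        InAk θ.L i.k i.η α₀ i.Ω U₀ → InAk θ.L i.k i.η α₀ i.Ω (mulCfg W U₀) → IsLandau146W θ.L i.k i.η (i.Ω 0) (i.Λs i.k) U₀ f W →
        ∀ A' : Site θ.D → Fin θ.D → θ.𝔸, (∀ y τ, IsSelfAdjoint (A' y τ)) →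
        (∀ j, j ≤ i.k → ∀ (y : Site θ.D) (τ : Fin θ.D), SideTouches (i.Ω j) y τ →
          W y τ = cfgExp i.η A' y τ ∧ ‖A' y τ‖ ≤ α₂ * ((θ.L : ℝ) ^ j * i.η)⁻¹) →
        (∀ (y : Site θ.D) (τ : Fin θ.D), (∀ j, j ≤ i.k → ¬ SideTouches (i.Ω j) y τ) → A' y τ = 0) →
        msup θ.L i.k i.η (-(1 : ℝ)) (fun j (b : Site θ.D × Fin θ.D) => SideTouches (i.Ω j) b.1 b.2) (fun b => A' b.1 b.2)
            ≤ B₀ * (bondNorm θ.L i.k i.η (-(3 : ℝ)) i.Ω (fun x μ => Jcur i.η U₀ A' μ x)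
              + wsup 1 (fun p : {p : ℕ × (Site θ.D × Fin θ.D) // p.1 ≤ i.k ∧ p.2 ∈ towerBondsP θ.L i.Ω (i.Λs i.k) p.1} =>
                  linCovIter θ.L U₀ (iEta i.η A') p.1.1 p.1.2.1 p.1.2.2)) + γ'' * B₀ * (α₀ + α₁) ∧
          msup θ.L i.k i.η (-(2 : ℝ)) (fun j (t : Fin θ.D × Fin θ.D × Site θ.D) => SideTouches (i.Ω j) t.2.2 t.2.1)
              (fun t => covDerivFwd i.η U₀ t.1 (fun z => A' z t.2.1) t.2.2)
            ≤ B₀ * (bondNorm θ.L i.k i.η (-(3 : ℝ)) i.Ω (fun x μ => Jcur i.η U₀ A' μ x)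
              + wsup 1 (fun p : {p : ℕ × (Site θ.D × Fin θ.D) // p.1 ≤ i.k ∧ p.2 ∈ towerBondsP θ.L i.Ω (i.Λs i.k) p.1} =>
                  linCovIter θ.L U₀ (iEta i.η A') p.1.1 p.1.2.1 p.1.2.2)) + γ'' * B₀ * (α₀ + α₁) ∧
          bondNorm θ.L i.k i.η (-(3 : ℝ)) i.Ω (fun x μ => pdiv i.η U₀ (plaqCovDeriv i.η U₀ A') μ x)
            ≤ B₀ * (bondNorm θ.L i.k i.η (-(3 : ℝ)) i.Ω (fun x μ => Jcur i.η U₀ A' μ x)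
              + wsup 1 (fun p : {p : ℕ × (Site θ.D × Fin θ.D) // p.1 ≤ i.k ∧ p.2 ∈ towerBondsP θ.L i.Ω (i.Λs i.k) p.1} =>
                  linCovIter θ.L U₀ (iEta i.η A') p.1.1 p.1.2.1 p.1.2.2)) + γ'' * B₀ * (α₀ + α₁) ∧
          bondNorm θ.L i.k i.η (-(3 : ℝ)) i.Ω (fun x μ => covLap i.η U₀ (fun z => A' z μ) x)
            ≤ B₀ * (bondNorm θ.L i.k i.η (-(3 : ℝ)) i.Ω (fun x μ => Jcur i.η U₀ A' μ x)
              + wsup 1 (fun p : {p : ℕ × (Site θ.D × Fin θ.D) // p.1 ≤ i.k ∧ p.2 ∈ towerBondsP θ.L i.Ω (i.Λs i.k) p.1} =>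
                  linCovIter θ.L U₀ (iEta i.η A') p.1.1 p.1.2.1 p.1.2.2)) + γ'' * B₀ * (α₀ + α₁) ∧
          msup θ.L i.k i.η (-(2 + β)) (fun j (q : Fin θ.D × Fin θ.D × (Site θ.D × Site θ.D)) =>
                q.2.2 ∈ AdmPair i.η len ∧ q.2.2.1 ∈ i.Ω j ∧ q.2.2.2 ∈ i.Ω j)
              (fun q => hquot i.η β len U₀ (covDerivFwd i.η U₀ q.1 (fun z => A' z q.2.1)) q.2.2)
            ≤ B₀β * (bondNorm θ.L i.k i.η (-(3 : ℝ)) i.Ω (fun x μ => Jcur i.η U₀ A' μ x)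
              + wsup 1 (fun p : {p : ℕ × (Site θ.D × Fin θ.D) // p.1 ≤ i.k ∧ p.2 ∈ towerBondsP θ.L i.Ω (i.Λs i.k) p.1} =>
                  linCovIter θ.L U₀ (iEta i.η A') p.1.1 p.1.2.1 p.1.2.2)) + γβ * (α₀ + α₁) := by
  have hL : 1 ≤ θ.L := le_trans (by norm_num) θ.two_le_L
  obtain ⟨B₀, B₀β, cP3, γ'', γβ, hB₀, hB₀β, hcP3, hγ'', hγβ, H⟩ :=
    exists_sockB9P3src_topCube (𝔹 := θ.𝔸) hD θ.two_le_L M hρ hk hβ hlen hγ₈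
  refine ⟨B₀, B₀β, cP3, γ'', γβ, hB₀, hB₀β, hcP3, hγ'', hγβ, fun a i hΩ hkk hlaws hdom h15 => ?_⟩
  have hΛ : ∀ l, l ≤ k → i.Λs k l = B11Eq7Convention.Lam θ.L (cubeFam true θ.L a M ρ k) k l := fun l hl => by
    have h := Λs_eq_lam_of_lamTop hL i hlaws hdom h15 (m := i.k) le_rfl (l := l) (by rw [hkk]; exact hl)
    rwa [hkk, hΩ] at h
  have hΛ0 : i.Λs k 0 = (cube θ.L a M ρ k 1)ᶜ := by rw [hΛ 0 (Nat.zero_le k), lamK_cubeFam_true_zero hL a M ρ hk]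
  have hΛj : ∀ j, 1 ≤ j → j ≤ k → i.Λs k j = cubeLamS θ.L a M ρ k k j := fun j hj1 hjk => by
    rw [hΛ j hjk, lamK_cubeFam_true_pos hL a M ρ hj1 hjk]
  rw [hkk, hΩ]
  exact H a i.η i.hη i.Λs hΛ0 hΛj

/-- ★★ **THE SAME WITH [4] (3.40)'s ONE-POINT PAIR CLASS ON LINE 5** (`q.2.2 ∈ AdmPair ∧ q.2.2.1 ∈ Ω_j` — the letter of `B8Prop3SrcZd3HPGamma`'s hypothesis `SB9srcH`
at a family member; from the core `srcLines_topCube`, whose Hölder line runs over any pair class inside the admissible pairs).  Same constants-before-members shape, so for a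
family `ι : J → ZdIdx` of law members over top-cube towers of ONE shape the constants are uniform in `J`.  PER MEMBER SHAPE — NOT [4] Thm 3.3. [cite: Balaban1985RegularSpaces, (1.146) p.101, (1.59) p.86, (1.5) p.77, (1.131) p.99; Balaban1985BackgroundPropagators, Thm 3.3 p.399, (3.40) p.397] -/
theorem sockB9P3src_topCube_lawMember_onePoint (θ : Stage3Params) [FiniteDimensional ℂ θ.𝔸] (hD : 2 ≤ θ.D) (M : ℕ) {ρ : ℕ} (hρ : θ.L ≤ ρ)
    {k : ℕ} (hk : 1 ≤ k) {β : ℝ} (hβ : 0 ≤ β) {len : Site θ.D → ℝ} (hlen : ∀ z : Site θ.D, z ≠ 0 → 1 ≤ len z) {γ₈ : ℝ} (hγ₈ : 0 < γ₈) :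
    ∃ B₀ B₀β cP3 γ'' γβ : ℝ, 0 < B₀ ∧ 0 < B₀β ∧ 0 < cP3 ∧ 0 < γ'' ∧ 0 < γβ ∧
      ∀ (a : Site θ.D) (i : ZdIdx θ.D θ.L), i.Ω = cubeFam true θ.L a M ρ k → i.k = k →
      IdxB8Laws θ.L i → DomainSeq θ.L i.Ω → (∀ l, l < i.k → ∀ z ∈ i.Λs i.k l, ((θ.L : ℤ) ^ l) • z ∈ Lam θ.L i.Ω l) →
      ∀ α₀ α₁ α₂ : ℝ, 0 < α₀ → α₀ ≤ cP3 → 0 < α₁ → 0 < α₂ → α₂ ≤ cP3 →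
        ∀ (U₀ W : Site θ.D → Fin θ.D → θ.𝔸ˣ), (∀ x κ, U₀ x κ ∈ unitaryUnits θ.𝔸) → (∀ x κ, W x κ ∈ unitaryUnits θ.𝔸) →
        ∀ f : Site θ.D → θ.𝔸, InR138 θ.L i.k i.η (i.Ω 0) (i.Λs i.k) U₀ f →
        (∀ x, IsSelfAdjoint (f x)) → (∀ x, x ∉ i.Ω 0 → f x = 0) →
        Bdd θ.L i.k i.η (-(2 : ℝ)) (fun j (x : Site θ.D) => x ∈ i.Ω j) f →
        msup θ.L i.k i.η (-(2 : ℝ)) (fun j (x : Site θ.D) => x ∈ i.Ω j) f < γ₈ * (α₀ + α₁) →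
        msup θ.L i.k i.η (-(3 : ℝ)) (fun j (p : Fin θ.D × Site θ.D) => p.2 ∈ i.Ω j) (fun p => covDerivFwd i.η U₀ p.1 f p.2) < γ₈ * (α₀ + α₁) →
        InAk θ.L i.k i.η α₀ i.Ω U₀ → InAk θ.L i.k i.η α₀ i.Ω (mulCfg W U₀) → IsLandau146W θ.L i.k i.η (i.Ω 0) (i.Λs i.k) U₀ f W →
        ∀ A' : Site θ.D → Fin θ.D → θ.𝔸, (∀ y τ, IsSelfAdjoint (A' y τ)) →
        (∀ j, j ≤ i.k → ∀ (y : Site θ.D) (τ : Fin θ.D), SideTouches (i.Ω j) y τ →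
          W y τ = cfgExp i.η A' y τ ∧ ‖A' y τ‖ ≤ α₂ * ((θ.L : ℝ) ^ j * i.η)⁻¹) →
        (∀ (y : Site θ.D) (τ : Fin θ.D), (∀ j, j ≤ i.k → ¬ SideTouches (i.Ω j) y τ) → A' y τ = 0) →
        msup θ.L i.k i.η (-(1 : ℝ)) (fun j (b : Site θ.D × Fin θ.D) => SideTouches (i.Ω j) b.1 b.2) (fun b => A' b.1 b.2)
            ≤ B₀ * (bondNorm θ.L i.k i.η (-(3 : ℝ)) i.Ω (fun x μ => Jcur i.η U₀ A' μ x)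
              + wsup 1 (fun p : {p : ℕ × (Site θ.D × Fin θ.D) // p.1 ≤ i.k ∧ p.2 ∈ towerBondsP θ.L i.Ω (i.Λs i.k) p.1} =>
                  linCovIter θ.L U₀ (iEta i.η A') p.1.1 p.1.2.1 p.1.2.2)) + γ'' * B₀ * (α₀ + α₁) ∧
          msup θ.L i.k i.η (-(2 : ℝ)) (fun j (t : Fin θ.D × Fin θ.D × Site θ.D) => SideTouches (i.Ω j) t.2.2 t.2.1)
              (fun t => covDerivFwd i.η U₀ t.1 (fun z => A' z t.2.1) t.2.2)
            ≤ B₀ * (bondNorm θ.L i.k i.η (-(3 : ℝ)) i.Ω (fun x μ => Jcur i.η U₀ A' μ x)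
              + wsup 1 (fun p : {p : ℕ × (Site θ.D × Fin θ.D) // p.1 ≤ i.k ∧ p.2 ∈ towerBondsP θ.L i.Ω (i.Λs i.k) p.1} =>
                  linCovIter θ.L U₀ (iEta i.η A') p.1.1 p.1.2.1 p.1.2.2)) + γ'' * B₀ * (α₀ + α₁) ∧
          bondNorm θ.L i.k i.η (-(3 : ℝ)) i.Ω (fun x μ => pdiv i.η U₀ (plaqCovDeriv i.η U₀ A') μ x)
            ≤ B₀ * (bondNorm θ.L i.k i.η (-(3 : ℝ)) i.Ω (fun x μ => Jcur i.η U₀ A' μ x)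
              + wsup 1 (fun p : {p : ℕ × (Site θ.D × Fin θ.D) // p.1 ≤ i.k ∧ p.2 ∈ towerBondsP θ.L i.Ω (i.Λs i.k) p.1} =>
                  linCovIter θ.L U₀ (iEta i.η A') p.1.1 p.1.2.1 p.1.2.2)) + γ'' * B₀ * (α₀ + α₁) ∧
          bondNorm θ.L i.k i.η (-(3 : ℝ)) i.Ω (fun x μ => covLap i.η U₀ (fun z => A' z μ) x)
            ≤ B₀ * (bondNorm θ.L i.k i.η (-(3 : ℝ)) i.Ω (fun x μ => Jcur i.η U₀ A' μ x)
              + wsup 1 (fun p : {p : ℕ × (Site θ.D × Fin θ.D) // p.1 ≤ i.k ∧ p.2 ∈ towerBondsP θ.L i.Ω (i.Λs i.k) p.1} =>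
                  linCovIter θ.L U₀ (iEta i.η A') p.1.1 p.1.2.1 p.1.2.2)) + γ'' * B₀ * (α₀ + α₁) ∧
          msup θ.L i.k i.η (-(2 + β)) (fun j (q : Fin θ.D × Fin θ.D × (Site θ.D × Site θ.D)) => q.2.2 ∈ AdmPair i.η len ∧ q.2.2.1 ∈ i.Ω j)
              (fun q => hquot i.η β len U₀ (covDerivFwd i.η U₀ q.1 (fun z => A' z q.2.1)) q.2.2)
            ≤ B₀β * (bondNorm θ.L i.k i.η (-(3 : ℝ)) i.Ω (fun x μ => Jcur i.η U₀ A' μ x)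
              + wsup 1 (fun p : {p : ℕ × (Site θ.D × Fin θ.D) // p.1 ≤ i.k ∧ p.2 ∈ towerBondsP θ.L i.Ω (i.Λs i.k) p.1} =>
                  linCovIter θ.L U₀ (iEta i.η A') p.1.1 p.1.2.1 p.1.2.2)) + γβ * (α₀ + α₁) := by
  have hL : 1 ≤ θ.L := le_trans (by norm_num) θ.two_le_L
  obtain ⟨B₀, B₀β, cP3, γ'', γβ, hB₀, hB₀β, hcP3, hγ'', hγβ, H⟩ :=
    srcLines_topCube (𝔹 := θ.𝔸) hD θ.two_le_L M hρ hk hβ hlen hγ₈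
  refine ⟨B₀, B₀β, cP3, γ'', γβ, hB₀, hB₀β, hcP3, hγ'', hγβ, fun a i hΩ hkk hlaws hdom h15 => ?_⟩
  have hΛ : ∀ l, l ≤ k → i.Λs k l = B11Eq7Convention.Lam θ.L (cubeFam true θ.L a M ρ k) k l := fun l hl => by
    have h := Λs_eq_lam_of_lamTop hL i hlaws hdom h15 (m := i.k) le_rfl (l := l) (by rw [hkk]; exact hl)
    rwa [hkk, hΩ] at h
  have hΛ0 : i.Λs k 0 = (cube θ.L a M ρ k 1)ᶜ := by rw [hΛ 0 (Nat.zero_le k), lamK_cubeFam_true_zero hL a M ρ hk]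
  have hΛj : ∀ j, 1 ≤ j → j ≤ k → i.Λs k j = cubeLamS θ.L a M ρ k k j := fun j hj1 hjk => by
    rw [hΛ j hjk, lamK_cubeFam_true_pos hL a M ρ hj1 hjk]
  rw [hkk, hΩ]
  exact H a i.η i.hη i.Λs hΛ0 hΛj (fun j q => q.2.2 ∈ AdmPair i.η len ∧ q.2.2.1 ∈ cubeFam true θ.L a M ρ k j) fun _ _ h => h.1

/-- ★★★ **THE SAME AT EVERY MEMBER OF THE (1.5)-OBEYING INDEX OF RECORD `IdxB8SubD θ` OVER A TOP-CUBE TOWER OF ONE SHAPE** (laws, (1.3)–(1.4), (1.5) are the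
index's fields). [cite: Balaban1985RegularSpaces, (1.146) p.101, (1.59) p.86, (1.5) p.77, (1.131) p.99; Balaban1985BackgroundPropagators, Thm 3.3 p.399] -/
theorem sockB9P3src_topCube_idxB8SubD (θ : Stage3Params) [FiniteDimensional ℂ θ.𝔸] (hD : 2 ≤ θ.D) (M : ℕ) {ρ : ℕ} (hρ : θ.L ≤ ρ)
    {k : ℕ} (hk : 1 ≤ k) {β : ℝ} (hβ : 0 ≤ β) {len : Site θ.D → ℝ} (hlen : ∀ z : Site θ.D, z ≠ 0 → 1 ≤ len z) {γ₈ : ℝ} (hγ₈ : 0 < γ₈) :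
    ∃ B₀ B₀β cP3 γ'' γβ : ℝ, 0 < B₀ ∧ 0 < B₀β ∧ 0 < cP3 ∧ 0 < γ'' ∧ 0 < γβ ∧
      ∀ (a : Site θ.D) (j : IdxB8SubD θ), j.1.1.1.1.Ω = cubeFam true θ.L a M ρ k → j.1.1.1.1.k = k →
      ∀ α₀ α₁ α₂ : ℝ, 0 < α₀ → α₀ ≤ cP3 → 0 < α₁ → 0 < α₂ → α₂ ≤ cP3 →
        ∀ (U₀ W : Site θ.D → Fin θ.D → θ.𝔸ˣ), (∀ x κ, U₀ x κ ∈ unitaryUnits θ.𝔸) → (∀ x κ, W x κ ∈ unitaryUnits θ.𝔸) →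
        ∀ f : Site θ.D → θ.𝔸, InR138 θ.L j.1.1.1.1.k j.1.1.1.1.η (j.1.1.1.1.Ω 0) (j.1.1.1.1.Λs j.1.1.1.1.k) U₀ f →
        (∀ x, IsSelfAdjoint (f x)) → (∀ x, x ∉ j.1.1.1.1.Ω 0 → f x = 0) →
        Bdd θ.L j.1.1.1.1.k j.1.1.1.1.η (-(2 : ℝ)) (fun l (x : Site θ.D) => x ∈ j.1.1.1.1.Ω l) f →
        msup θ.L j.1.1.1.1.k j.1.1.1.1.η (-(2 : ℝ)) (fun l (x : Site θ.D) => x ∈ j.1.1.1.1.Ω l) f < γ₈ * (α₀ + α₁) →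
        msup θ.L j.1.1.1.1.k j.1.1.1.1.η (-(3 : ℝ)) (fun l (p : Fin θ.D × Site θ.D) => p.2 ∈ j.1.1.1.1.Ω l)
          (fun p => covDerivFwd j.1.1.1.1.η U₀ p.1 f p.2) < γ₈ * (α₀ + α₁) →
        InAk θ.L j.1.1.1.1.k j.1.1.1.1.η α₀ j.1.1.1.1.Ω U₀ → InAk θ.L j.1.1.1.1.k j.1.1.1.1.η α₀ j.1.1.1.1.Ω (mulCfg W U₀) →
        IsLandau146W θ.L j.1.1.1.1.k j.1.1.1.1.η (j.1.1.1.1.Ω 0) (j.1.1.1.1.Λs j.1.1.1.1.k) U₀ f W →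
        ∀ A' : Site θ.D → Fin θ.D → θ.𝔸, (∀ y τ, IsSelfAdjoint (A' y τ)) →
        (∀ l, l ≤ j.1.1.1.1.k → ∀ (y : Site θ.D) (τ : Fin θ.D), SideTouches (j.1.1.1.1.Ω l) y τ →
          W y τ = cfgExp j.1.1.1.1.η A' y τ ∧ ‖A' y τ‖ ≤ α₂ * ((θ.L : ℝ) ^ l * j.1.1.1.1.η)⁻¹) →
        (∀ (y : Site θ.D) (τ : Fin θ.D), (∀ l, l ≤ j.1.1.1.1.k → ¬ SideTouches (j.1.1.1.1.Ω l) y τ) → A' y τ = 0) →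
        msup θ.L j.1.1.1.1.k j.1.1.1.1.η (-(1 : ℝ)) (fun l (b : Site θ.D × Fin θ.D) => SideTouches (j.1.1.1.1.Ω l) b.1 b.2) (fun b => A' b.1 b.2)
            ≤ B₀ * (bondNorm θ.L j.1.1.1.1.k j.1.1.1.1.η (-(3 : ℝ)) j.1.1.1.1.Ω (fun x μ => Jcur j.1.1.1.1.η U₀ A' μ x)
              + wsup 1 (fun p : {p : ℕ × (Site θ.D × Fin θ.D) //
                  p.1 ≤ j.1.1.1.1.k ∧ p.2 ∈ towerBondsP θ.L j.1.1.1.1.Ω (j.1.1.1.1.Λs j.1.1.1.1.k) p.1} =>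
                  linCovIter θ.L U₀ (iEta j.1.1.1.1.η A') p.1.1 p.1.2.1 p.1.2.2)) + γ'' * B₀ * (α₀ + α₁) ∧
          msup θ.L j.1.1.1.1.k j.1.1.1.1.η (-(2 : ℝ)) (fun l (t : Fin θ.D × Fin θ.D × Site θ.D) => SideTouches (j.1.1.1.1.Ω l) t.2.2 t.2.1)
              (fun t => covDerivFwd j.1.1.1.1.η U₀ t.1 (fun z => A' z t.2.1) t.2.2)
            ≤ B₀ * (bondNorm θ.L j.1.1.1.1.k j.1.1.1.1.η (-(3 : ℝ)) j.1.1.1.1.Ω (fun x μ => Jcur j.1.1.1.1.η U₀ A' μ x)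
              + wsup 1 (fun p : {p : ℕ × (Site θ.D × Fin θ.D) //
                  p.1 ≤ j.1.1.1.1.k ∧ p.2 ∈ towerBondsP θ.L j.1.1.1.1.Ω (j.1.1.1.1.Λs j.1.1.1.1.k) p.1} =>
                  linCovIter θ.L U₀ (iEta j.1.1.1.1.η A') p.1.1 p.1.2.1 p.1.2.2)) + γ'' * B₀ * (α₀ + α₁) ∧
          bondNorm θ.L j.1.1.1.1.k j.1.1.1.1.η (-(3 : ℝ)) j.1.1.1.1.Ω (fun x μ => pdiv j.1.1.1.1.η U₀ (plaqCovDeriv j.1.1.1.1.η U₀ A') μ x)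
            ≤ B₀ * (bondNorm θ.L j.1.1.1.1.k j.1.1.1.1.η (-(3 : ℝ)) j.1.1.1.1.Ω (fun x μ => Jcur j.1.1.1.1.η U₀ A' μ x)
              + wsup 1 (fun p : {p : ℕ × (Site θ.D × Fin θ.D) //
                  p.1 ≤ j.1.1.1.1.k ∧ p.2 ∈ towerBondsP θ.L j.1.1.1.1.Ω (j.1.1.1.1.Λs j.1.1.1.1.k) p.1} =>
                  linCovIter θ.L U₀ (iEta j.1.1.1.1.η A') p.1.1 p.1.2.1 p.1.2.2)) + γ'' * B₀ * (α₀ + α₁) ∧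
          bondNorm θ.L j.1.1.1.1.k j.1.1.1.1.η (-(3 : ℝ)) j.1.1.1.1.Ω (fun x μ => covLap j.1.1.1.1.η U₀ (fun z => A' z μ) x)
            ≤ B₀ * (bondNorm θ.L j.1.1.1.1.k j.1.1.1.1.η (-(3 : ℝ)) j.1.1.1.1.Ω (fun x μ => Jcur j.1.1.1.1.η U₀ A' μ x)
              + wsup 1 (fun p : {p : ℕ × (Site θ.D × Fin θ.D) //
                  p.1 ≤ j.1.1.1.1.k ∧ p.2 ∈ towerBondsP θ.L j.1.1.1.1.Ω (j.1.1.1.1.Λs j.1.1.1.1.k) p.1} =>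
                  linCovIter θ.L U₀ (iEta j.1.1.1.1.η A') p.1.1 p.1.2.1 p.1.2.2)) + γ'' * B₀ * (α₀ + α₁) ∧
          msup θ.L j.1.1.1.1.k j.1.1.1.1.η (-(2 + β)) (fun l (q : Fin θ.D × Fin θ.D × (Site θ.D × Site θ.D)) =>
                q.2.2 ∈ AdmPair j.1.1.1.1.η len ∧ q.2.2.1 ∈ j.1.1.1.1.Ω l ∧ q.2.2.2 ∈ j.1.1.1.1.Ω l)
              (fun q => hquot j.1.1.1.1.η β len U₀ (covDerivFwd j.1.1.1.1.η U₀ q.1 (fun z => A' z q.2.1)) q.2.2)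
            ≤ B₀β * (bondNorm θ.L j.1.1.1.1.k j.1.1.1.1.η (-(3 : ℝ)) j.1.1.1.1.Ω (fun x μ => Jcur j.1.1.1.1.η U₀ A' μ x)
              + wsup 1 (fun p : {p : ℕ × (Site θ.D × Fin θ.D) //
                  p.1 ≤ j.1.1.1.1.k ∧ p.2 ∈ towerBondsP θ.L j.1.1.1.1.Ω (j.1.1.1.1.Λs j.1.1.1.1.k) p.1} =>
                  linCovIter θ.L U₀ (iEta j.1.1.1.1.η A') p.1.1 p.1.2.1 p.1.2.2)) + γβ * (α₀ + α₁) := by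
  obtain ⟨B₀, B₀β, cP3, γ'', γβ, hB₀, hB₀β, hcP3, hγ'', hγβ, H⟩ := sockB9P3src_topCube_lawMember θ hD M hρ hk hβ hlen hγ₈
  exact ⟨B₀, B₀β, cP3, γ'', γβ, hB₀, hB₀β, hcP3, hγ'', hγβ, fun a j hΩ hkk => H a j.1.1.1.1 hΩ hkk j.1.1.2.toIdxB8Laws j.1.2 j.2⟩

end Literature.MathematicalPhysics.QuantumFieldTheory.Balaban1983to89.B8SockB9P3SrcAtTopCubeTowerMember

end
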